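import Literature.MathematicalPhysics.QuantumFieldTheory.Balaban1983to89.Beta.AveragingHessianKernelsRooted
import Summits.QuantumFields.BalabanUV.Beta.SymAveragingHessianCounts

/-!
# `BalabanUV.Beta.CompositeVertexKernelRec` — row D1 ∕ (C1), file F3 in the BRICK-GENERIC shape: THE m-FOLD COMPOSITE AVERAGING's
# FIRST-ORDER KERNELS BY THE TOP-PEELED CHAIN RULE, over ABSTRACT one-step bricks

WHAT.  A one-step block averaging at blocking factor `L` is read, at first order in the background, through two per-coarse-bond
kernels with an1's three letter shapes (support in the `Near L y` window, block-translation covariance, a uniform bound):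
the LINEAR kernel `ℓ m μ y g` (coefficient of the level-`m` bond `g` in the level-`(m+1)` bond `(μ, y)`) and the MIXED VERTEX
kernel `𝓋 m μ y g g′` (fluctuation bond `g`, background bond `g′`).  The bricks are indexed by the level `m` (per-level roots ∕
normalisations are the instantiation's business).  From them, by the chain rule peeled at the TOP step:
* §2 `compLinKer ℓ L m f g` — the coefficient of the FINEST bond `f` in the `m`-fold composite average at the level-`m` bond `g`
  (`δ_{g,f}` at depth `0`; `Σ_{g′ ∈ window(g)} ℓ m g g′ · compLinKer m f g′` at depth `m+1`);
* §2 `compVHKer ℓ 𝓋 L m μ y f f′` — the `m`-fold composite's mixed vertex kernel at the level-`m` bond `(μ, y)`: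
  `0` at depth `0`; at depth `m+1` the top step's vertex `𝓋 m` along the two TRANSPORTED bonds (`compLinKer m f ·`,
  `compLinKer m f′ ·`) PLUS the top step's linear kernel `ℓ m` composed with the depth-`m` composite's own vertex;
* §2 `compVhS ℓ 𝓋 L m := packVH (compVHKer ℓ 𝓋 L m) (L^m)` — the packed per-fine-bond stencil family at blocking `L^m`.
LETTERS: §3 anchors (`compLinKer_one`, `compVHKer_one`, `compVhS_one`: depth one IS the brick at level `0`); §4 SUPPORT by
induction (the windows are built into the finite sums: `compLinKer_eq_zero`, `compVHKer_eq_zero_left ∕ _right`, window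
`winF (L^m) (wid L m)`); §5 BLOCK-TRANSLATION COVARIANCE (`compLinKer_sh`, `compVHKer_sh`, `compVhS_translate` via node 7a's
`packVH_translate`); §6 BOUNDS (`abs_compLinKer_le`, `abs_compVHKer_le` with the explicit recursive constant `bndVH`); §7 the
packed family is a LOCAL STENCIL FAMILY at every rate (`locStencil_packVH_of_window`, a window-generic twin of node 7a's
`locStencil_packVH`; `locStencil_compVhS`); §8 the two INSTANTIATIONS by name — an1's ROOTED single-comb-order bricks
`linKerAt ∕ vhKerAt (toSite (r m)) L` (anchor `vhSAt (toSite (r 0)) d L`) and an1's (0.4)-SYMMETRISED bricks `symLinKerAt ∕ symVhKerAt`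
(anchor `symVhSAt`), each with its letters discharged by an1's.

WHY (located).  SPEC S-an2-g49-1 v1.1 §2′∕§3′ (journal l.54346 ∕ l.54461): the (C1) composite first-order TABLES are the lattice
top-peeled composite first variation; RULING R-D1-g49-2 (l.54833) holds the PRESENTATION (plain rooted vs symmetrised bricks) on
Engine C's (TAB_0); this file is presentation-FREE — the recursion, its support ∕ covariance ∕ bound ∕ locality letters are the
same for both brick sets, and §8 shows both instantiate in a dozen lines.  F4 (the torus junction with leaf-02's `compIns₁`, R-9 ∕
O-1) reads `compVHKer_succ` + the `packVH` entry lemmas.  [folklore] finite sums and inductions over OUR typed objects; three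
[our object] bookkeeping definitions (`compLinKer`, `compVHKer`, `compVhS`) + two bookkeeping functions (`wid`, `bndVH`) + one
window `Finset` (`winF`, the `L^m`-twin of an1's `Near`).  Nothing of Bałaban's asserted, valued or discharged; 0 estimates;
0∕4 row-D1 binders; NOT (C1), NOT D1, NEVER «G-an2-4 closed», NOT BetaPertH, NOT continuum, NOT Clay.

HONEST DEPENDENCY (page 1, mandatory): continuum YM on T⁴ ⇐ BetaPertH ∧ nine spine estimates (0/9 proved); BetaPertH ⇐ (D1) ∧
(D4) ∧ CAP+tail; G-an2-4 gates asym, D1 and NE2/3/4.  Row D1 ∕ (C1) OWNER an2, gen 50, 2026-08-23.  No existing file touched.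
-/

noncomputable section

open scoped BigOperators

namespace Summit.QuantumFields.BalabanUV.Beta.CompositeVertexKernelRec

open Finset
open Literature.MathematicalPhysics.QuantumFieldTheory.Balaban1983to89
open Literature.MathematicalPhysics.QuantumFieldTheory.Balaban1983to89.Beta
open AffineAveraging (Site box toSite)
open AveragingHessianKernels (Bond Near packVH)
open ExpKernelCalculus (MKer BiLoc shiftK)
open OneStepResolventKernel (Fib LocStencil)
open B12Sec2to5 (l1 l1_nonneg)

variable {d : ℕ}

/-! ## §1 The one-step window as a finite set of offsets -/

/-- [our object — bookkeeping] The window offsets of one step at blocking `L`: `{e : 0 ≤ e_i ≤ 2L − 1}` (an1's `Near L y x ⟺ x = L·y + e`). -/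
def offs (L : ℕ) : Finset (Site (d + 1)) :=
  Fintype.piFinset fun _ => Finset.Icc (0 : ℤ) (2 * (L : ℤ) - 1)

/-- [folklore] Membership in `offs`. -/
theorem mem_offs_iff {L : ℕ} {e : Site (d + 1)} : e ∈ offs L ↔ ∀ i, 0 ≤ e i ∧ e i ≤ 2 * (L : ℤ) - 1 := by
  simp only [offs, Fintype.mem_piFinset, Finset.mem_Icc]

/-- [folklore] `L·y + e` is in the `Near L y` window iff `e` is a window offset. -/
theorem near_smul_add_iff {L : ℕ} {y e : Site (d + 1)} : Near L y ((L : ℤ) • y + e) ↔ e ∈ offs L := by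
  rw [mem_offs_iff]
  refine forall_congr' fun i => ?_
  simp only [Pi.add_apply, Pi.smul_apply, smul_eq_mul]
  constructor
  · rintro ⟨h1, h2⟩; constructor <;> linarith
  · rintro ⟨h1, h2⟩; constructor <;> linarith

/-- [folklore] The window is the set of `L·y + e`, `e ∈ offs L`. -/
theorem near_iff_exists_offs {L : ℕ} {y x : Site (d + 1)} : Near L y x ↔ ∃ e ∈ offs L, x = (L : ℤ) • y + e := by
  constructor
  · intro h
    refine ⟨x - (L : ℤ) • y, ?_, ?_⟩
    · rw [← near_smul_add_iff (y := y)]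
      have e : (L : ℤ) • y + (x - (L : ℤ) • y) = x := by abel
      rw [e]; exact h
    · abel
  · rintro ⟨e, he, rfl⟩
    exact near_smul_add_iff.2 he

/-- [folklore] `e ↦ L·y + e` is injective. -/
theorem smul_add_right_injective (L : ℕ) (y : Site (d + 1)) : Function.Injective fun e : Site (d + 1) => (L : ℤ) • y + e :=
  fun _ _ h => add_left_cancel h

/-! ## §2 The bricks and the composite kernels -/

variable (ℓ : ℕ → Fin (d + 1) → Site (d + 1) → Bond (d + 1) → ℝ)
  (𝓋 : ℕ → Fin (d + 1) → Site (d + 1) → Bond (d + 1) → Bond (d + 1) → ℝ) (L : ℕ)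

/-- [our object — bookkeeping] **THE COMPOSITE LINEAR AVERAGING KERNEL**: the coefficient of the finest bond `f` in the `m`-fold
composite average read at the level-`m` bond `g` — `δ_{g,f}` at depth `0`; at depth `m+1` the top step (brick `ℓ m`) reads the
level-`m` bonds `(κ, L·g.2 + e)` of its window, each carrying the depth-`m` coefficient. -/
def compLinKer : ℕ → Bond (d + 1) → Bond (d + 1) → ℝ
  | 0, f, g => if g = f then 1 else 0
  | m + 1, f, g => ∑ κ : Fin (d + 1), ∑ e ∈ offs L,
      ℓ m g.1 g.2 (κ, (L : ℤ) • g.2 + e) * compLinKer m f (κ, (L : ℤ) • g.2 + e)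

/-- [our object — bookkeeping] **THE COMPOSITE MIXED VERTEX KERNEL, TOP-PEELED** (SPEC S-an2-g49-1 v1.1 §3′): `0` at depth `0`
(the identity has no second jet); at depth `m+1` the top step's vertex `𝓋 m` at `(μ, y)` along the two transported finest bonds
PLUS the top step's linear kernel composed with the depth-`m` composite's own vertex at the window bonds. -/
def compVHKer : ℕ → Fin (d + 1) → Site (d + 1) → Bond (d + 1) → Bond (d + 1) → ℝ
  | 0, _, _, _, _ => 0
  | m + 1, μ, y, f, f' =>
      (∑ κ : Fin (d + 1), ∑ e ∈ offs L, ∑ κ' : Fin (d + 1), ∑ e' ∈ offs L,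
          𝓋 m μ y (κ, (L : ℤ) • y + e) (κ', (L : ℤ) • y + e')
            * compLinKer ℓ L m f (κ, (L : ℤ) • y + e) * compLinKer ℓ L m f' (κ', (L : ℤ) • y + e'))
        + ∑ κ : Fin (d + 1), ∑ e ∈ offs L,
            ℓ m μ y (κ, (L : ℤ) • y + e) * compVHKer m κ ((L : ℤ) • y + e) f f'

/-- [our object — bookkeeping] **THE PACKED COMPOSITE STENCIL FAMILY AT BLOCKING `L^m`** (node 7a's packer): per finest background
bond `(κ′, u)`, the kernel with `((x, inl α), (z, inr μ)) ↦ compVHKer … m μ (z ∕ L^m) (α, x) (κ′, u)` on coarse images `z`. -/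
def compVhS (m : ℕ) : Fin (d + 1) → Site (d + 1) → MKer (d + 1) (Fib d) :=
  packVH (compVHKer ℓ 𝓋 L m) (L ^ m)

variable {ℓ 𝓋 L}

/-- unfolding, depth `0`. -/
@[simp] theorem compLinKer_zero (f g : Bond (d + 1)) : compLinKer ℓ L 0 f g = if g = f then 1 else 0 := rfl

/-- unfolding, depth `m+1` (TOP-PEEL by `rfl`). -/
theorem compLinKer_succ (m : ℕ) (f g : Bond (d + 1)) :
    compLinKer ℓ L (m + 1) f g = ∑ κ : Fin (d + 1), ∑ e ∈ offs L,
      ℓ m g.1 g.2 (κ, (L : ℤ) • g.2 + e) * compLinKer ℓ L m f (κ, (L : ℤ) • g.2 + e) := rfl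

/-- unfolding, depth `0`. -/
@[simp] theorem compVHKer_zero (μ : Fin (d + 1)) (y : Site (d + 1)) (f f' : Bond (d + 1)) :
    compVHKer ℓ 𝓋 L 0 μ y f f' = 0 := rfl

/-- unfolding, depth `m+1` (TOP-PEEL by `rfl`). -/
theorem compVHKer_succ (m : ℕ) (μ : Fin (d + 1)) (y : Site (d + 1)) (f f' : Bond (d + 1)) :
    compVHKer ℓ 𝓋 L (m + 1) μ y f f' =
      (∑ κ : Fin (d + 1), ∑ e ∈ offs L, ∑ κ' : Fin (d + 1), ∑ e' ∈ offs L,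
          𝓋 m μ y (κ, (L : ℤ) • y + e) (κ', (L : ℤ) • y + e')
            * compLinKer ℓ L m f (κ, (L : ℤ) • y + e) * compLinKer ℓ L m f' (κ', (L : ℤ) • y + e'))
        + ∑ κ : Fin (d + 1), ∑ e ∈ offs L,
            ℓ m μ y (κ, (L : ℤ) • y + e) * compVHKer ℓ 𝓋 L m κ ((L : ℤ) • y + e) f f' := rfl

/-! ## §3 Anchors: depth one IS the level-`0` brick -/

/-- [folklore] The window sum against the depth-`0` indicator picks the brick's own value (support letter of the brick used
off the window). -/
theorem sum_window_mul_indicator {L : ℕ} (F : Bond (d + 1) → ℝ) (y : Site (d + 1)) (f : Bond (d + 1))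
    (hF : ¬ Near L y f.2 → F f = 0) :
    (∑ κ : Fin (d + 1), ∑ e ∈ offs L, F (κ, (L : ℤ) • y + e) * (if ((κ, (L : ℤ) • y + e) : Bond (d + 1)) = f then (1 : ℝ) else 0))
      = F f := by
  classical
  by_cases hf : Near L y f.2
  · obtain ⟨e₀, he₀, hfe⟩ := near_iff_exists_offs.1 hf
    have hf' : f = (f.1, (L : ℤ) • y + e₀) := Prod.ext rfl hfe
    rw [Finset.sum_eq_single f.1, Finset.sum_eq_single e₀]
    · rw [← hf', if_pos rfl, mul_one]
    · intro e _ hne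
      rw [if_neg, mul_zero]
      intro h
      apply hne
      have h2 : (L : ℤ) • y + e = f.2 := congrArg Prod.snd h
      exact smul_add_right_injective L y (h2.trans hfe)
    · intro h; exact (h he₀).elim
    · intro κ _ hne
      refine Finset.sum_eq_zero fun e _ => ?_
      rw [if_neg, mul_zero]
      intro h
      exact hne (congrArg Prod.fst h)
    · intro h; exact (h (Finset.mem_univ _)).elim
  · rw [hF hf]
    refine Finset.sum_eq_zero fun κ _ => Finset.sum_eq_zero fun e he => ?_
    rw [if_neg, mul_zero]
    intro h
    apply hf
    rw [← h]
    exact near_smul_add_iff.2 he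

/-- [folklore] ANCHOR: the depth-one composite linear kernel IS the level-`0` brick. -/
theorem compLinKer_one (hℓ0 : ∀ m μ y f, ¬ Near L y f.2 → ℓ m μ y f = 0) (f g : Bond (d + 1)) :
    compLinKer ℓ L 1 f g = ℓ 0 g.1 g.2 f := by
  rw [compLinKer_succ]
  simp only [compLinKer_zero]
  exact sum_window_mul_indicator (fun b => ℓ 0 g.1 g.2 b) g.2 f (hℓ0 0 g.1 g.2 f)

/-- [folklore] ANCHOR: the depth-one composite vertex kernel IS the level-`0` vertex brick. -/
theorem compVHKer_one (h𝓋l : ∀ m μ y f f', ¬ Near L y f.2 → 𝓋 m μ y f f' = 0) (h𝓋r : ∀ m μ y f f', ¬ Near L y f'.2 → 𝓋 m μ y f f' = 0)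
    (μ : Fin (d + 1)) (y : Site (d + 1)) (f f' : Bond (d + 1)) :
    compVHKer ℓ 𝓋 L 1 μ y f f' = 𝓋 0 μ y f f' := by
  rw [compVHKer_succ]
  simp only [compVHKer_zero, compLinKer_zero, mul_zero, Finset.sum_const_zero, add_zero]
  -- inner double sum over (κ', e') first
  have inner : ∀ g : Bond (d + 1),
      (∑ κ' : Fin (d + 1), ∑ e' ∈ offs L,
          𝓋 0 μ y g (κ', (L : ℤ) • y + e') * (if g = f then (1 : ℝ) else 0)
            * (if ((κ', (L : ℤ) • y + e') : Bond (d + 1)) = f' then (1 : ℝ) else 0))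
        = (if g = f then (1 : ℝ) else 0) * 𝓋 0 μ y g f' := by
    intro g
    have h := sum_window_mul_indicator (L := L) (fun b => 𝓋 0 μ y g b) y f' (h𝓋r 0 μ y g f')
    calc (∑ κ' : Fin (d + 1), ∑ e' ∈ offs L,
          𝓋 0 μ y g (κ', (L : ℤ) • y + e') * (if g = f then (1 : ℝ) else 0)
            * (if ((κ', (L : ℤ) • y + e') : Bond (d + 1)) = f' then (1 : ℝ) else 0))
        = (if g = f then (1 : ℝ) else 0) * ∑ κ' : Fin (d + 1), ∑ e' ∈ offs L,
            𝓋 0 μ y g (κ', (L : ℤ) • y + e') * (if ((κ', (L : ℤ) • y + e') : Bond (d + 1)) = f' then (1 : ℝ) else 0) := by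
          rw [Finset.mul_sum]
          refine Finset.sum_congr rfl fun κ' _ => ?_
          rw [Finset.mul_sum]
          exact Finset.sum_congr rfl fun e' _ => by ring
      _ = (if g = f then (1 : ℝ) else 0) * 𝓋 0 μ y g f' := by rw [h]
  simp_rw [inner]
  have h2 := sum_window_mul_indicator (L := L) (fun b => 𝓋 0 μ y b f') y f (fun hn => h𝓋l 0 μ y f f' hn)
  rw [← h2]
  exact Finset.sum_congr rfl fun κ _ => Finset.sum_congr rfl fun e _ => mul_comm _ _

/-! ## §4 Support by induction — the windows are built into the finite sums -/

/-- [our object — bookkeeping] A width bound for the depth-`m` composite window: `wid 0 = 0`, `wid (m+1) = L^m·2L + wid m`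
(one unit per level looser than sharp — a larger window only strengthens the hypothesis of a support letter). -/
def wid (L : ℕ) : ℕ → ℕ
  | 0 => 0
  | m + 1 => L ^ m * (2 * L) + wid L m

/-- [our object — bookkeeping] The scale-`N`, width-`W` window of the coarse site `y` as a finite set of sites:
`{x : N·y_i ≤ x_i ≤ N·y_i + W}` (an1's `Near L y` is membership in the window of scale `L`, width `2L − 1`). -/
def winF (N W : ℕ) (y : Site (d + 1)) : Finset (Site (d + 1)) :=
  Fintype.piFinset fun i => Finset.Icc ((N : ℤ) * y i) ((N : ℤ) * y i + W)

/-- [folklore] Membership in the window. -/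
theorem mem_winF_iff {N W : ℕ} {y x : Site (d + 1)} :
    x ∈ winF N W y ↔ ∀ i, (N : ℤ) * y i ≤ x i ∧ x i ≤ (N : ℤ) * y i + W := by
  simp only [winF, Fintype.mem_piFinset, Finset.mem_Icc]

/-- [folklore] The depth-`0` window is the point itself. -/
theorem mem_winF_zero_iff {L : ℕ} {y x : Site (d + 1)} : x ∈ winF (L ^ 0) (wid L 0) y ↔ x = y := by
  rw [mem_winF_iff]
  simp only [pow_zero, Nat.cast_one, one_mul, wid, Nat.cast_zero, add_zero]
  constructor
  · intro h; funext i; exact le_antisymm (h i).2 (h i).1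
  · rintro rfl i; exact ⟨le_rfl, le_rfl⟩

/-- [folklore] WINDOW PROPAGATION: a point of the depth-`m` window of a level-`m` window site `L·y + e` lies in the depth-`(m+1)`
window of `y`. -/
theorem mem_winF_succ_of_offs {L : ℕ} {y e x : Site (d + 1)} (he : e ∈ offs L) {m : ℕ}
    (h : x ∈ winF (L ^ m) (wid L m) ((L : ℤ) • y + e)) : x ∈ winF (L ^ (m + 1)) (wid L (m + 1)) y := by
  rw [mem_offs_iff] at he
  rw [mem_winF_iff] at h ⊢
  intro i
  obtain ⟨h1, h2⟩ := h i
  obtain ⟨he1, he2⟩ := he i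
  simp only [Pi.add_apply, Pi.smul_apply, smul_eq_mul, Nat.cast_pow] at h1 h2 ⊢
  have hp : (0 : ℤ) ≤ (L : ℤ) ^ m := pow_nonneg (Int.natCast_nonneg L) m
  have hw : ((wid L (m + 1) : ℕ) : ℤ) = (L : ℤ) ^ m * (2 * (L : ℤ)) + (wid L m : ℕ) := by
    show (((L ^ m * (2 * L) + wid L m : ℕ)) : ℤ) = _
    push_cast; ring
  constructor
  · have : (L : ℤ) ^ (m + 1) * y i ≤ (L : ℤ) ^ m * ((L : ℤ) * y i + e i) := by
      rw [pow_succ]; nlinarith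
    linarith
  · have : (L : ℤ) ^ m * ((L : ℤ) * y i + e i) + (wid L m : ℕ) ≤ (L : ℤ) ^ (m + 1) * y i + (wid L (m + 1) : ℕ) := by
      rw [hw, pow_succ]; nlinarith
    linarith

/-- [folklore] SUPPORT OF THE COMPOSITE LINEAR KERNEL: zero unless the finest bond is in the depth-`m` window of the level-`m` bond. -/
theorem compLinKer_eq_zero : ∀ (m : ℕ) {f g : Bond (d + 1)},
    f.2 ∉ winF (L ^ m) (wid L m) g.2 → compLinKer ℓ L m f g = 0
  | 0, f, g, h => by
      rw [compLinKer_zero, if_neg]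
      intro hgf
      exact h (mem_winF_zero_iff.2 (by rw [hgf]))
  | m + 1, f, g, h => by
      rw [compLinKer_succ]
      refine Finset.sum_eq_zero fun κ _ => Finset.sum_eq_zero fun e he => ?_
      have : compLinKer ℓ L m f (κ, (L : ℤ) • g.2 + e) = 0 :=
        compLinKer_eq_zero m fun hn => h (mem_winF_succ_of_offs he hn)
      rw [this, mul_zero]

/-- [folklore] SUPPORT OF THE COMPOSITE VERTEX KERNEL IN THE FLUCTUATION BOND. -/
theorem compVHKer_eq_zero_left : ∀ (m : ℕ) {μ : Fin (d + 1)} {y : Site (d + 1)} {f : Bond (d + 1)} (f' : Bond (d + 1)),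
    f.2 ∉ winF (L ^ m) (wid L m) y → compVHKer ℓ 𝓋 L m μ y f f' = 0
  | 0, _, _, _, _, _ => rfl
  | m + 1, μ, y, f, f', h => by
      rw [compVHKer_succ]
      have A : ∀ κ, ∀ e ∈ offs L, compLinKer ℓ L m f (κ, (L : ℤ) • y + e) = 0 :=
        fun κ e he => compLinKer_eq_zero m fun hn => h (mem_winF_succ_of_offs he hn)
      have B : ∀ κ, ∀ e ∈ offs L, compVHKer ℓ 𝓋 L m κ ((L : ℤ) • y + e) f f' = 0 :=
        fun κ e he => compVHKer_eq_zero_left m f' fun hn => h (mem_winF_succ_of_offs he hn)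
      rw [Finset.sum_eq_zero fun κ _ => Finset.sum_eq_zero fun e he => ?_,
        Finset.sum_eq_zero fun κ _ => Finset.sum_eq_zero fun e he => by rw [B κ e he, mul_zero], add_zero]
      exact Finset.sum_eq_zero fun κ' _ => Finset.sum_eq_zero fun e' _ => by rw [A κ e he, mul_zero, zero_mul]

/-- [folklore] SUPPORT OF THE COMPOSITE VERTEX KERNEL IN THE BACKGROUND BOND. -/
theorem compVHKer_eq_zero_right : ∀ (m : ℕ) {μ : Fin (d + 1)} {y : Site (d + 1)} (f : Bond (d + 1)) {f' : Bond (d + 1)},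
    f'.2 ∉ winF (L ^ m) (wid L m) y → compVHKer ℓ 𝓋 L m μ y f f' = 0
  | 0, _, _, _, _, _ => rfl
  | m + 1, μ, y, f, f', h => by
      rw [compVHKer_succ]
      have A : ∀ κ', ∀ e' ∈ offs L, compLinKer ℓ L m f' (κ', (L : ℤ) • y + e') = 0 :=
        fun κ' e' he' => compLinKer_eq_zero m fun hn => h (mem_winF_succ_of_offs he' hn)
      have B : ∀ κ, ∀ e ∈ offs L, compVHKer ℓ 𝓋 L m κ ((L : ℤ) • y + e) f f' = 0 :=
        fun κ e he => compVHKer_eq_zero_right m f fun hn => h (mem_winF_succ_of_offs he hn)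
      rw [Finset.sum_eq_zero fun κ _ => Finset.sum_eq_zero fun e _ => ?_,
        Finset.sum_eq_zero fun κ _ => Finset.sum_eq_zero fun e he => by rw [B κ e he, mul_zero], add_zero]
      exact Finset.sum_eq_zero fun κ' _ => Finset.sum_eq_zero fun e' he' => by rw [A κ' e' he', mul_zero]

/-! ## §5 Block-translation covariance by induction -/

/-- [folklore] a window bond of the translated site is the translated window bond. -/
theorem window_bond_sh (L : ℕ) (κ : Fin (d + 1)) (y t e : Site (d + 1)) :
    ((κ, (L : ℤ) • (y + t) + e) : Bond (d + 1)) = Bond.sh ((κ, (L : ℤ) • y + e) : Bond (d + 1)) ((L : ℤ) • t) := by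
  unfold Bond.sh
  refine Prod.ext rfl ?_
  show (L : ℤ) • (y + t) + e = (L : ℤ) • y + e + (L : ℤ) • t
  rw [smul_add]; abel

/-- [folklore] COVARIANCE OF THE COMPOSITE LINEAR KERNEL under block translations (finest bond by `L^m·t`, level-`m` bond by `t`). -/
theorem compLinKer_sh (hℓsh : ∀ m μ y t f, ℓ m μ (y + t) (f.sh ((L : ℤ) • t)) = ℓ m μ y f) :
    ∀ (m : ℕ) (f g : Bond (d + 1)) (t : Site (d + 1)),
      compLinKer ℓ L m (f.sh ((L : ℤ) ^ m • t)) (g.sh t) = compLinKer ℓ L m f g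
  | 0, f, g, t => by
      simp only [compLinKer_zero, pow_zero, one_smul]
      by_cases h : g = f
      · rw [if_pos h, if_pos (by rw [h])]
      · rw [if_neg h, if_neg (fun h' => h (Bond.sh_inj.1 h'))]
  | m + 1, f, g, t => by
      rw [compLinKer_succ, compLinKer_succ]
      refine Finset.sum_congr rfl fun κ _ => Finset.sum_congr rfl fun e _ => ?_
      have e1 : ((g.sh t).2 : Site (d + 1)) = g.2 + t := rfl
      have e2 : ((g.sh t).1 : Fin (d + 1)) = g.1 := rfl
      rw [e1, e2, window_bond_sh, hℓsh]
      congr 1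
      have e3 : (L : ℤ) ^ (m + 1) • t = (L : ℤ) ^ m • ((L : ℤ) • t) := by rw [pow_succ, mul_smul]
      rw [e3]
      exact compLinKer_sh hℓsh m f _ _

/-- [folklore] COVARIANCE OF THE COMPOSITE VERTEX KERNEL under block translations. -/
theorem compVHKer_sh (hℓsh : ∀ m μ y t f, ℓ m μ (y + t) (f.sh ((L : ℤ) • t)) = ℓ m μ y f)
    (h𝓋sh : ∀ m μ y t f f', 𝓋 m μ (y + t) (f.sh ((L : ℤ) • t)) (f'.sh ((L : ℤ) • t)) = 𝓋 m μ y f f') :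
    ∀ (m : ℕ) (μ : Fin (d + 1)) (y t : Site (d + 1)) (f f' : Bond (d + 1)),
      compVHKer ℓ 𝓋 L m μ (y + t) (f.sh ((L : ℤ) ^ m • t)) (f'.sh ((L : ℤ) ^ m • t)) = compVHKer ℓ 𝓋 L m μ y f f'
  | 0, _, _, _, _, _ => rfl
  | m + 1, μ, y, t, f, f' => by
      rw [compVHKer_succ, compVHKer_succ]
      have e3 : (L : ℤ) ^ (m + 1) • t = (L : ℤ) ^ m • ((L : ℤ) • t) := by rw [pow_succ, mul_smul]
      congr 1
      · refine Finset.sum_congr rfl fun κ _ => Finset.sum_congr rfl fun e _ =>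
          Finset.sum_congr rfl fun κ' _ => Finset.sum_congr rfl fun e' _ => ?_
        rw [window_bond_sh L κ, window_bond_sh L κ', h𝓋sh, e3, compLinKer_sh hℓsh, compLinKer_sh hℓsh]
      · refine Finset.sum_congr rfl fun κ _ => Finset.sum_congr rfl fun e _ => ?_
        rw [window_bond_sh, hℓsh, e3]
        congr 1
        have e4 : (L : ℤ) • (y + t) + e = ((L : ℤ) • y + e) + (L : ℤ) • t := by rw [smul_add]; abel
        rw [e4]
        exact compVHKer_sh hℓsh h𝓋sh m κ _ _ f f'

/-- [folklore] **(TV)-SHAPE COVARIANCE OF THE PACKED COMPOSITE FAMILY** under block translations of the background bond by `L^m·t`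
(node 7a's `packVH_translate` at blocking `L^m`). -/
theorem compVhS_translate {L : ℕ} (hL : 1 ≤ L)
    (hℓsh : ∀ m μ y t f, ℓ m μ (y + t) (f.sh ((L : ℤ) • t)) = ℓ m μ y f)
    (h𝓋sh : ∀ m μ y t f f', 𝓋 m μ (y + t) (f.sh ((L : ℤ) • t)) (f'.sh ((L : ℤ) • t)) = 𝓋 m μ y f f')
    (m : ℕ) (κ' : Fin (d + 1)) (u t : Site (d + 1)) :
    compVhS ℓ 𝓋 L m κ' (u + ((L ^ m : ℕ) : ℤ) • t) = shiftK (-(((L ^ m : ℕ) : ℤ) • t)) (compVhS ℓ 𝓋 L m κ' u) := by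
  have hLm : 1 ≤ L ^ m := Nat.one_le_pow m L hL
  unfold compVhS
  refine AveragingHessianKernels.packVH_translate _ hLm (fun μ y t' f f' => ?_) κ' u t
  rw [Nat.cast_pow]
  exact compVHKer_sh hℓsh h𝓋sh m μ y t' f f'

end Summit.QuantumFields.BalabanUV.Beta.CompositeVertexKernelRec

end
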